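import Summits.QuantumFields.BalabanUV.T4Continuum.Support.NE7EtaRegauging

/-!
# NE7EtaPlainLipschitzWitness — route #1 of the NE7 crux, hardest stub S1∕L7b-background: a 2×2 WITNESS that the PLAIN-difference
# Lipschitz conjuncts of WAKE-1's typing are NOT gauge-invariant (while `NE7EtaRegauging` proves the covariant ones are)

Cell `pub-balaban`, rung (B)+1 sub-cell t4, lineage `b2b-balaban-t4-ne7-p1`, generation 22 (CRUX PROVER NE7 #1, ruling e34b3e0c); crux
skeleton `t4/skeletons/NE7-CRUX-R1.md` v1.6 §3ter, GAPS A-ne7p1g22-1 (repair census R1–R4).  HONEST FRAMING (page 1): FIXED FINITE T⁴,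
rung (B)+1; NE7, NE3 NOT PRINTED in [Balaban1984PropagatorsI]–[Balaban1989LargeFieldII] and NOT PROVED here; continuum YM on T⁴ ⇐ BetaPertH ∧
nine spine estimates (0/9 proved); BetaPertH ⇐ (D1) ∧ (D4) ∧ CAP+tail; G-an2-4 gates asym, D1 and NE2/3/4; NOT infinite volume, NOT mass
gap, NOT Clay.

WHAT.  On `ℤ¹` with `U(2)`: the constant skew direction `Z ≡ Z₀ = diag(i, −i)` has ALL plain lattice differences zero, but after the
unitary site gauge `w` (the permutation matrix at the site with coordinate `1`, the identity elsewhere) the gauged direction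
`dirGauge w Z x κ = Ad (w (x + e κ)) (Z x κ)` (the END-point law of `AveragingDeficitLocality.gaugeAct_vary`) has a NON-ZERO plain
difference at the origin (`= 2Z₀`).  So a bound «`‖Z (x + e μ) κ − Z x κ‖ ≤ Λ₁ξ²` inside NE3's `∃(u, Z)`» is a statement about the
gauge REPRESENTATIVE of run B's `W`, not about its orbit — the located objection A-ne7p1g22-1 as a kernel fact (`plainLipschitz_not_gauge_invariant`);
the covariant conjuncts of INTERFACE REQUEST amendment 3 do not have this defect (`NE7EtaRegauging.covariantData_regauge`).
HONEST.  A two-by-two example ([folklore]); nothing of NE3∕NE7 asserted; 0 def; 0 sorry.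
-/

set_option autoImplicit false

open scoped Matrix

namespace Summit.QuantumFields.BalabanUV.T4Continuum.NE7EtaPlainLipschitzWitness

open Literature.MathematicalPhysics.QuantumFieldTheory.Balaban1983to89
open B7Prop1Explicit B7Prop2Explicit
open T4AveragingDeficitWall hiding Site Plane Plaq Bond
open AveragingDeficitLocality (dirGauge)

noncomputable section

/-- **THE PLAIN LIPSCHITZ CONJUNCTS ARE NOT GAUGE INVARIANT** (`d = 1`, `U(2)`): there are a unitary site gauge `w` and a skew direction
`Z` whose plain lattice differences all vanish while the gauged direction `dirGauge w Z` has a non-zero plain difference. [folklore] -/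
theorem plainLipschitz_not_gauge_invariant :
    ∃ (w : Site 1 → (Matrix (Fin 2) (Fin 2) ℂ)ˣ) (Z : Site 1 → Fin 1 → Matrix (Fin 2) (Fin 2) ℂ),
      (∀ x, w x ∈ unitaryUnits (Matrix (Fin 2) (Fin 2) ℂ)) ∧ IsSkewDir Z ∧
      (∀ (x : Site 1) (μ κ : Fin 1), Z (x + e μ) κ - Z x κ = 0) ∧
      ∃ (x : Site 1) (μ κ : Fin 1), dirGauge w Z (x + e μ) κ - dirGauge w Z x κ ≠ 0 := by
  -- the permutation matrix and the skew diagonal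
  set P : Matrix (Fin 2) (Fin 2) ℂ := !![0, 1; 1, 0] with hP
  set Z₀ : Matrix (Fin 2) (Fin 2) ℂ := !![Complex.I, 0; 0, -Complex.I] with hZ₀
  have hPP : P * P = 1 := by
    rw [hP, Matrix.mul_fin_two, Matrix.one_fin_two]; norm_num
  have hPstar : star P = P := by
    rw [hP]
    ext i j
    fin_cases i <;> fin_cases j <;> simp [Matrix.star_apply]
  set uP : (Matrix (Fin 2) (Fin 2) ℂ)ˣ := ⟨P, P, hPP, hPP⟩ with huP
  have huPu : uP ∈ unitaryUnits (Matrix (Fin 2) (Fin 2) ℂ) := by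
    rw [mem_unitaryUnits, Unitary.mem_iff]
    exact ⟨by rw [show ((uP : (Matrix (Fin 2) (Fin 2) ℂ)ˣ) : Matrix (Fin 2) (Fin 2) ℂ) = P from rfl, hPstar, hPP],
      by rw [show ((uP : (Matrix (Fin 2) (Fin 2) ℂ)ˣ) : Matrix (Fin 2) (Fin 2) ℂ) = P from rfl, hPstar, hPP]⟩
  have hAd : Ad uP Z₀ = -Z₀ := by
    unfold Ad
    rw [show ((uP : (Matrix (Fin 2) (Fin 2) ℂ)ˣ) : Matrix (Fin 2) (Fin 2) ℂ) = P from rfl,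
      show (((uP⁻¹ : (Matrix (Fin 2) (Fin 2) ℂ)ˣ)) : Matrix (Fin 2) (Fin 2) ℂ) = P from rfl, hP, hZ₀,
      Matrix.mul_fin_two, Matrix.mul_fin_two]
    ext i j
    fin_cases i <;> fin_cases j <;> simp
  have hZ₀skew : Z₀ ∈ skewAdjoint (Matrix (Fin 2) (Fin 2) ℂ) := by
    rw [skewAdjoint.mem_iff, hZ₀]
    ext i j
    fin_cases i <;> fin_cases j <;> simp [Matrix.star_apply, Complex.conj_I]
  -- the site gauge: P at the site with coordinate 1, identity elsewhere; the constant direction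
  refine ⟨fun x => if x 0 = 1 then uP else 1, fun _ _ => Z₀, fun x => ?_, fun _ _ => hZ₀skew, fun _ _ _ => sub_self _,
    (0 : Site 1), 0, 0, ?_⟩
  · by_cases hx : x 0 = 1
    · simp only [hx, if_true]; exact huPu
    · simp only [hx, if_false]; exact (unitaryUnits _).one_mem
  · -- at the origin: Ad (w (0 + e0 + e0)) Z₀ − Ad (w (0 + e0)) Z₀ = Z₀ − (−Z₀) ≠ 0
    have h1 : ((0 : Site 1) + e (0 : Fin 1)) (0 : Fin 1) = 1 := by simp [e_apply]
    have h2 : ((0 : Site 1) + e (0 : Fin 1) + e (0 : Fin 1)) (0 : Fin 1) = 2 := by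
      simp only [Pi.add_apply, Pi.zero_apply, e_apply, if_true]; norm_num
    simp only [dirGauge, h1, h2, if_true]
    rw [if_neg (by norm_num), AveragingDeficitNearIdentity.Ad_one, hAd, sub_neg_eq_add]
    intro h
    have h00 : (Z₀ + Z₀) 0 0 = (0 : Matrix (Fin 2) (Fin 2) ℂ) 0 0 := by rw [h]
    simp [hZ₀] at h00

end

end Summit.QuantumFields.BalabanUV.T4Continuum.NE7EtaPlainLipschitzWitness
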